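import Summits.Ventures.HodgeRepro.CMType

/-!
# The Galois groups of Galois CM fields of degree 6, 8 and 12

Blind re-derivation cell `pub-hodge-repro`, seat `typer` (gen 1).  Continues `CMType.lean`.

A Galois CM field `K` of degree `2g` has Galois group `G` of order `2g` containing complex conjugation as a
CENTRAL involution `c` (`CMType.lean`, module docstring).  Up to isomorphism the groups of order 6, 8, 12
with a non-trivial centre of even order are (the group-theoretic facts below are all `decide`d):

* order 6: `C₆` (the symmetric group `S₃ = D₃` has trivial centre);
* order 8: `C₈`, `C₄ × C₂`, `C₂ × C₂ × C₂`, `D₄` (dihedral of order 8), `Q₈` (quaternion);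
* order 12: `C₁₂`, `C₆ × C₂`, `D₆` (dihedral of order 12), `Dic₃ = C₃ ⋊ C₄` (dicyclic of order 12;
  `A₄` has trivial centre).

Each group is realised as a Mathlib type; `cc_<group>` is a central involution and `complexConjs_<group>`
lists ALL central involutions (`HodgeRepro.complexConjs`).  Mathlib conventions: `DihedralGroup n` has
elements `r i` (rotations) and `sr i` (reflections), `i : ZMod n`; `QuaternionGroup n` (order `4n`) has
elements `a i`, `xa i`, `i : ZMod (2n)`, with `xa i ^ 2 = a n`; cyclic and abelian groups are written
multiplicatively via `Multiplicative (ZMod n)` / `Multiplicative (ZMod m × ZMod n)`.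
-/

open Finset

namespace HodgeRepro

/-! ### Order 6 -/

/-- The cyclic group of order 6. -/
abbrev C6 := Multiplicative (ZMod 6)

/-- Complex conjugation in `C₆`: the element of order 2. -/
def cc_C6 : C6 := Multiplicative.ofAdd 3

/-- `cc_C6` is a complex conjugation (`decide`). -/
theorem cc_C6_isComplexConj : IsComplexConj cc_C6 := by decide

/-- `C₆` has exactly one central involution. -/
theorem complexConjs_C6 : complexConjs C6 = {cc_C6} := by decide

/-- `|C₆| = 6`. -/
theorem card_C6 : Fintype.card C6 = 6 := by decide

/-- `S₃ = D₃` has no central involution: no Galois CM field has Galois group `S₃`. -/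
theorem complexConjs_D3 : complexConjs (DihedralGroup 3) = ∅ := by decide

/-! ### Order 8 -/

/-- The cyclic group of order 8. -/
abbrev C8 := Multiplicative (ZMod 8)

/-- Complex conjugation in `C₈`. -/
def cc_C8 : C8 := Multiplicative.ofAdd 4

/-- `cc_C8` is a complex conjugation (`decide`). -/
theorem cc_C8_isComplexConj : IsComplexConj cc_C8 := by decide

/-- `C₈` has exactly one central involution. -/
theorem complexConjs_C8 : complexConjs C8 = {cc_C8} := by decide

/-- `|C₈| = 8`. -/
theorem card_C8 : Fintype.card C8 = 8 := by decide

/-- The group `C₄ × C₂`. -/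
abbrev C4xC2 := Multiplicative (ZMod 4 × ZMod 2)

/-- The involution `(2, 0)` of `C₄ × C₂` (a square: `2·(1,0)`). -/
def cc_C4xC2_sq : C4xC2 := Multiplicative.ofAdd (2, 0)

/-- The involution `(0, 1)` of `C₄ × C₂` (not a square). -/
def cc_C4xC2_ns : C4xC2 := Multiplicative.ofAdd (0, 1)

/-- The involution `(2, 1)` of `C₄ × C₂` (not a square; `≅ (0,1)` under the automorphism
`(a, b) ↦ (a + 2b, b)`). -/
def cc_C4xC2_ns' : C4xC2 := Multiplicative.ofAdd (2, 1)

/-- `(2, 0)` is a complex conjugation of `C₄ × C₂` (`decide`). -/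
theorem cc_C4xC2_sq_isComplexConj : IsComplexConj cc_C4xC2_sq := by decide

/-- `(0, 1)` is a complex conjugation of `C₄ × C₂` (`decide`). -/
theorem cc_C4xC2_ns_isComplexConj : IsComplexConj cc_C4xC2_ns := by decide

/-- `(2, 1)` is a complex conjugation of `C₄ × C₂` (`decide`). -/
theorem cc_C4xC2_ns'_isComplexConj : IsComplexConj cc_C4xC2_ns' := by decide

/-- The three central involutions of `C₄ × C₂`. -/
theorem complexConjs_C4xC2 : complexConjs C4xC2 = {cc_C4xC2_sq, cc_C4xC2_ns, cc_C4xC2_ns'} := by decide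

/-- `|C₄ × C₂| = 8`. -/
theorem card_C4xC2 : Fintype.card C4xC2 = 8 := by decide

/-- The elementary abelian group `C₂ × C₂ × C₂`. -/
abbrev C2xC2xC2 := Multiplicative (ZMod 2 × ZMod 2 × ZMod 2)

/-- A representative involution of `C₂³` (all 7 are equivalent under `GL₃(𝔽₂)`). -/
def cc_C2xC2xC2 : C2xC2xC2 := Multiplicative.ofAdd (1, 0, 0)

/-- `(1, 0, 0)` is a complex conjugation of `C₂³` (`decide`). -/
theorem cc_C2xC2xC2_isComplexConj : IsComplexConj cc_C2xC2xC2 := by decide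

/-- Every non-identity element of `C₂³` is a central involution. -/
theorem complexConjs_C2xC2xC2 : complexConjs C2xC2xC2 = univ.erase 1 := by decide

/-- `C₂³` has 7 central involutions. -/
theorem card_complexConjs_C2xC2xC2 : (complexConjs C2xC2xC2).card = 7 := by decide

/-- `|C₂³| = 8`. -/
theorem card_C2xC2xC2 : Fintype.card C2xC2xC2 = 8 := by decide

/-- The dihedral group of order 8. -/
abbrev D4 := DihedralGroup 4

/-- Complex conjugation in `D₄`: the rotation by `π`, `r 2`, the unique central involution. -/
def cc_D4 : D4 := DihedralGroup.r 2

/-- `r²` is a complex conjugation of `D₄` (`decide`). -/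
theorem cc_D4_isComplexConj : IsComplexConj cc_D4 := by decide

/-- `D₄` has exactly one central involution. -/
theorem complexConjs_D4 : complexConjs D4 = {cc_D4} := by decide

/-- `|D₄| = 8`. -/
theorem card_D4 : Fintype.card D4 = 8 := by decide

/-- The quaternion group of order 8 (`QuaternionGroup 2`). -/
abbrev Q8 := QuaternionGroup 2

/-- Complex conjugation in `Q₈`: `−1 = a 2`, the unique central involution. -/
def cc_Q8 : Q8 := QuaternionGroup.a 2

/-- `-1` is a complex conjugation of `Q₈` (`decide`). -/
theorem cc_Q8_isComplexConj : IsComplexConj cc_Q8 := by decide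

/-- `Q₈` has exactly one central involution. -/
theorem complexConjs_Q8 : complexConjs Q8 = {cc_Q8} := by decide

/-- `|Q₈| = 8`. -/
theorem card_Q8 : Fintype.card Q8 = 8 := by decide

/-! ### Order 12 -/

/-- The cyclic group of order 12. -/
abbrev C12 := Multiplicative (ZMod 12)

/-- Complex conjugation in `C₁₂`. -/
def cc_C12 : C12 := Multiplicative.ofAdd 6

/-- `cc_C12` is a complex conjugation (`decide`). -/
theorem cc_C12_isComplexConj : IsComplexConj cc_C12 := by decide

/-- `C₁₂` has exactly one central involution. -/
theorem complexConjs_C12 : complexConjs C12 = {cc_C12} := by decide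

/-- `|C₁₂| = 12`. -/
theorem card_C12 : Fintype.card C12 = 12 := by decide

/-- The group `C₆ × C₂`. -/
abbrev C6xC2 := Multiplicative (ZMod 6 × ZMod 2)

/-- A representative involution of `C₆ × C₂ ≅ C₃ × C₂ × C₂` (all 3 involutions are equivalent under
automorphisms of the `2`-part). -/
def cc_C6xC2 : C6xC2 := Multiplicative.ofAdd (3, 0)

/-- The other two involutions of `C₆ × C₂`. -/
def cc_C6xC2' : C6xC2 := Multiplicative.ofAdd (0, 1)

/-- The involution `(3, 1)` of `C₆ × C₂`. -/
def cc_C6xC2'' : C6xC2 := Multiplicative.ofAdd (3, 1)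

/-- `(3, 0)` is a complex conjugation of `C₆ × C₂` (`decide`). -/
theorem cc_C6xC2_isComplexConj : IsComplexConj cc_C6xC2 := by decide

/-- The three central involutions of `C₆ × C₂`. -/
theorem complexConjs_C6xC2 : complexConjs C6xC2 = {cc_C6xC2, cc_C6xC2', cc_C6xC2''} := by decide

/-- `|C₆ × C₂| = 12`. -/
theorem card_C6xC2 : Fintype.card C6xC2 = 12 := by decide

/-- The dihedral group of order 12. -/
abbrev D6 := DihedralGroup 6

/-- Complex conjugation in `D₆`: the rotation by `π`, `r 3`, the unique central involution. -/
def cc_D6 : D6 := DihedralGroup.r 3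

/-- `r³` is a complex conjugation of `D₆` (`decide`). -/
theorem cc_D6_isComplexConj : IsComplexConj cc_D6 := by decide

/-- `D₆` has exactly one central involution. -/
theorem complexConjs_D6 : complexConjs D6 = {cc_D6} := by decide

/-- `|D₆| = 12`. -/
theorem card_D6 : Fintype.card D6 = 12 := by decide

/-- The dicyclic group of order 12 (`QuaternionGroup 3 = C₃ ⋊ C₄`). -/
abbrev Dic3 := QuaternionGroup 3

/-- Complex conjugation in `Dic₃`: `a 3`, the unique central involution. -/
def cc_Dic3 : Dic3 := QuaternionGroup.a 3

/-- `a³` is a complex conjugation of `Dic₃` (`decide`). -/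
theorem cc_Dic3_isComplexConj : IsComplexConj cc_Dic3 := by decide

/-- `Dic₃` has exactly one central involution. -/
theorem complexConjs_Dic3 : complexConjs Dic3 = {cc_Dic3} := by decide

/-- `|Dic₃| = 12`. -/
theorem card_Dic3 : Fintype.card Dic3 = 12 := by decide

/-! ### Counting CM types

A CM type picks one element of each pair `{g, c g}`, so there are `2^(|G|/2)` of them. -/

/-- `C₆` has `2³ = 8` CM types. -/
theorem card_cmTypes_C6 : (cmTypes cc_C6).card = 8 := by decide

/-- `C₈` has `2⁴ = 16` CM types. -/
theorem card_cmTypes_C8 : (cmTypes cc_C8).card = 16 := by decide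

/-- `D₄` has `16` CM types. -/
theorem card_cmTypes_D4 : (cmTypes cc_D4).card = 16 := by decide

/-- `Q₈` has `16` CM types. -/
theorem card_cmTypes_Q8 : (cmTypes cc_Q8).card = 16 := by decide

end HodgeRepro
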